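import Summits.CriticalPhenomena.PercolationContinuityZ3.Theorems.PercNearOneGluingNoHeavyQuantTwinMove
import Summits.CriticalPhenomena.PercolationContinuityZ3.Theorems.PercNearOneGluingNoHeavyQuantGatedShiftDECHolds
import HarnessLib

/-!
# QUANT lane R8, T-DEC, leg (III): THE BLOB GATE MOVE IS A TWO-LAW MIXTURE AT ONE LAYER —
# `gate_q(slice μ a g) = (1−g)·gate_q μ + g·gate_q(μ(· − a))`, the conjecture `MixedShiftDEC` (exact census: 0 / 383 803 boundary-pushed
# instances, each single hypothesis refuted), its layers `j < a` PROVED, and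
# **`MixedShiftDEC ⟹ SDECUpTo x Q M μ → SDECUpTo x Q (M+a) (slice μ a g)` for EVERY heavy blob `{0, a; g}` (PM in full)**

builds on p205010 (kernel theorem, internal audit signed; external expert review pending)

Statement + support file (`--supports stmt-CriticalPhenomena-4575`), QUANT lane lead seat prim-quant-lead (gen 29), rung R8 of
`run/shared/lean/prim/quant/LADDER.md`.  One `@[conjecture]` definition (`LawDec.MixedShiftDEC`), theorems with standard axioms, no sorries.
Continues typer g27's `…QuantGateMoveBlob` (move lemma (M), `sdecUpTo_slice_relay` = the case `a = 1`), typer g26's `…QuantGatedShiftDECHolds`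
(Conjecture R: `gatedShift_sdecUpTo`) and arm-1 g39's `…QuantTwinMove` (`TwinMoveDEC`: the same target through twins; `decAtT_of_giantMass_ge`).

THE OBSERVATION (lead g29, LEAD-NOTES-G29 / README V307).  The conclusion law of PM — the gated slice `gate_q(slice μ a g)` of a law `μ` by a
heavy blob `{0, a; g}` — is, because `gate_q` is affine and `slice μ a g = (1−g)·μ + g·μ(·−a)`, the MIXTURE
`(1−g)·ν + g·W`,  `ν := gate_q μ`,  `W := gate_q(μ(· − a))` (the GATED SHIFT of Conjecture R),
and its target `q(T + ag)` is the same mixture `(1−g)·qT + g·q(T + a)` of the two means.  Both mixture components are DEC at the layer `j`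
in question by KERNEL theorems whenever `μ` is SDEC up to `Q`: `ν` by `SDECUpTo` itself (or Theorem A `decAt_of_top_le` for `j ≥ M`), `W` by
typer g26's `gatedShift_sdecUpTo` (whose one-layer engine `decAt_gatedShift_succ` moves the hypothesis from layer `j − a` of `ν` to layer
`j` of `W`).  So PM for every blob size `a` follows from ONE statement about ONE layer and TWO laws:

**CONJECTURE `MixedShiftDEC`** (z-form, matching `decAtT_gateMoveBlob`): `ν` a top-affordable probability law on `{0..M}` (mean `S`,
`y·M ≤ S`), `0 ≤ z ≤ ν 0`, `W := shiftBut ν a z` (= `ν` with everything except the mass `z` of its zero atom shifted up by `a`; mean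
`S + a(1−z)`), `g ≤ 1`, `y ≤ (1−z)·g`.  If `ν` is DEC at `(y, S, j)` AND `W` is DEC at `(y, S + a(1−z), j)` then `(1−g)ν + gW` is DEC at
`(y, S + ag(1−z), j)`.

EVIDENCE (exact; lead g29 kit j167377 / j167378 / j167379 on item 4575, engine seat folder `explore/kitclimb/census_mtr.py`: float LP screening
+ exact rational re-derivation of every float failure; the floor `y` bisected to the EDGE of each variant's hypotheses so that they bind;
`M ≤ 9`, `a ≤ 7`, all layers, `g = 1` and `g < 1`, threshold `y = (1−z)g` exactly in half the instances; z = ν 0 (the pslice form)):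
both hypotheses (this conjecture): **0 failures / 191 905** (116 018 at layers `j ≥ M`, 75 867 below); hypothesis on `ν` ALONE: 196 exact
failures (166 at `j ≥ M`: pure-shift-type witnesses, e.g. `ν = {1: 2/9, 5: 7/9}`, `a = 1`, `g = 1`, `j = 5`); hypothesis on `W` ALONE: 16 exact
failures, all at `j < M` (e.g. `ν = {1: 5/16, 2: 1/16, 7: 5/8}`, `a = 1`, `j = 5`), 0 at `j ≥ M` (there `ν`'s hypothesis is Theorem A);
PM1 WINDOW form (control): 0 / 191 905.  The general z-form (kit j167528 / j167529, `M ≤ 9`, `a ≤ 7`): **0 / 191 898** (z uniform in `[0, ν 0]`: 96 021; z = 0: 48 207; z = ν 0: 47 670), against 205 exact failures with the hypothesis on `ν` alone and 20 (all at `j < M`) with the hypothesis on `W` alone; deep exact re-check of every numerically borderline instance (float margin in `(−10⁻⁷, 0)`; kit j167714, 47 969 further instances, exact bisection of the floor to the edge of the hypotheses): 34 / 34 resolve to DEC, 0 genuine.  Adversarial CLIMBS on the law masses against the PM1 window form and against `SingleGateConvClosed` (kit j167313 / j167320, 3 520 climbs × 140 steps, `M ≤ 9`, `a ≤ 7`,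 second factors with ≤ 4 atoms): minimum margin exactly 0 (the sharp threshold family `ν = gate δ_M`), never negative.  SHAPE NEGATIVE: the same
mixture statement with `W` replaced by an ARBITRARY law of the same zero atom and larger mean is FALSE (exact witness `ν = {0: 1/10, 1: 27/100,
2: 63/100}`, `W′ = {0: 1/10, 1: 9/55, 4: 81/110}`, `g = 9/10`, `j = 2`, `y = 16588593/22528000`: TA, threshold and both one-layer hypotheses
hold, the mixture is not DEC) — the shift structure of `W` is used.  MINIMAX REMARK: by LP duality a dual-transfer certificate with rows
{`ν`'s duality at ONE layer `J`, mean, zero-atom identity} exists for every price system of the conclusion iff the single-layer-`J` form of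
PM1 holds for every law with the instance's constants — so arm-1/arm-2's closed-form programme (README V306 (e)) is a proof of a single-layer
statement; `MixedShiftDEC` says WHICH single layers: `j` for `ν` and (through `W`) `j − a` for `ν`.

* `LawDec.shiftBut ν a z` — `ν` with all but the mass `z` of its zero atom shifted up by `a`.
* `LawDec.MixedShiftDEC` (`@[conjecture]`).
* `LawDec.gate_shift_eq_shiftBut`, `LawDec.gate_slice_eq_mix` — the two identities behind the observation.
* **`LawDec.mixedShift_of_lt`** — the conjecture at the layers `j < a`, unconditionally (criterion E: the shifted copies are giants of mass
  `g(1−z) ≥ y`).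
* **`LawDec.sdecUpTo_slice_of_mixedShift : MixedShiftDEC → (SDECUpTo x Q M μ → SDECUpTo x Q (M+a) (slice μ a g))`** for every
  top-affordable probability law `μ` and every heavy blob `x ≤ g ≤ 1`, `a ≥ 1` — PM in full (= `GateMove`/`GatedConvEmptyFree` for a blob
  second factor), modulo the conjecture; **`LawDec.sdec_slice_of_mixedShift`** (`Q = 1`).

HONEST STATUS: `MixedShiftDEC` is OPEN (as are arm-1's `TwinMoveDEC`, typer's (M) for general `a`, `GateMove`, `GatedConvEmptyFree`,
`SDECConvClosed`, `SingleGateConvClosed`, `TreeDEC`, `FarTreeRow`); the RATE class log\* and the honest sentence of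
`run/shared/lean/prim/quant/README.md` are unchanged.

[this work]; (M) and the a = 1 theorem: prim-quant-stmt g27; Conjecture R: prim-quant-stmt g26; `TwinMoveDEC`/criterion-E lemma: prim-quant-arm-1
g39; slice theorem: prim-quant-stmt g24 / prim-quant-census-2 (this lane).  Nothing here is cited as a published result.  The gluing rows
served [cite: KozmaNitzan2024, Conjecture 3 (p. 15)]; product measure [cite: Grimmett1999, §1.3 p. 10].
-/

noncomputable section

namespace Summit.CriticalPhenomena.PercolationContinuityZ3.Theorems

namespace Quant

open Finset

namespace LawDec

/-! ### The partially shifted law and the conjecture -/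

/-- **`shiftBut ν a z`**: the law `ν` with everything EXCEPT the mass `z` of its zero atom shifted up by `a` — atoms `0 ↦ z`,
`a ↦ ν 0 − z`, `k + a ↦ ν k` (`k ≥ 1`).  For `ν = gate_q μ`, `z = 1 − q` this is `gate_q(μ(· − a))` (`gate_shift_eq_shiftBut`). [this work] -/
def shiftBut (ν : ℕ → ℝ) (a : ℕ) (z : ℝ) : ℕ → ℝ :=
  fun h => (if h = 0 then z else 0) + (if a ≤ h then ν (h - a) else 0) - (if h = a then z else 0)

/-- **CONJECTURE (MIXED SHIFT; lead g29).**  `0 < y < 1`, `0 ≤ z ≤ ν 0`, `g ≤ 1`, `y ≤ (1−z)·g`, `1 ≤ a`; `ν ≥ 0` a probability law on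
`{0..M}` with mean `S` and `y·M ≤ S`.  If `ν` is DEC at `(y, S, j)` and `W = shiftBut ν a z` is DEC at `(y, S + a(1−z), j)` (its mean),
then the mixture `(1−g)·ν + g·W` is DEC at `(y, S + a·g·(1−z), j)` (its mean).  With `ν = gate_q μ`, `z = 1 − q` the mixture is
`gate_q(slice μ a g)` (`gate_slice_eq_mix`), `W` is Conjecture R's gated shift, and the statement is PM for the blob `{0, a; g}` at the
layer `j` from hypotheses at the SINGLE layer `j` on two laws (`sdecUpTo_slice_of_mixedShift`).  KNOWN: `j < a` (`mixedShift_of_lt`);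
`a = 1` via typer g27's `sdecUpTo_slice_relay` (as a consequence for SDEC laws).  EVIDENCE: exact boundary-pushed censuses, 0 / 383 803,
each single hypothesis refuted (module docstring; kit j167377–j167379, j167528–j167529, j167714 on item 4575).
builds on p205010 (kernel theorem, internal audit signed; external expert review pending). [this work] [status: open] -/
@[conjecture] def MixedShiftDEC : Prop :=
  ∀ (y z g S : ℝ) (a j M : ℕ) (ν : ℕ → ℝ),
    0 < y → y < 1 → 0 ≤ z → z ≤ ν 0 → g ≤ 1 → y ≤ (1 - z) * g → 1 ≤ a →
    (∀ h, 0 ≤ ν h) → (∀ h, M < h → ν h = 0) → (∑ h ∈ Finset.range (M + 1), ν h = 1) →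
    S = ∑ h ∈ Finset.range (M + 1), (h : ℝ) * ν h → y * (M : ℝ) ≤ S →
    DECAtT y S j (M + a) ν →
    DECAtT y (S + (a : ℝ) * (1 - z)) j (M + a) (shiftBut ν a z) →
    DECAtT y (S + (a : ℝ) * g * (1 - z)) j (M + a) (fun h => (1 - g) * ν h + g * shiftBut ν a z h)

/-! ### The two identities -/

/-- the gated shift of Conjecture R is `shiftBut (gate μ q) a (1 − q)` (`a ≥ 1`). [this work] -/
theorem gate_shift_eq_shiftBut (μ : ℕ → ℝ) (q : ℝ) (a : ℕ) (ha : 1 ≤ a) :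
    gate (fun t => if a ≤ t then μ (t - a) else 0) q = shiftBut (gate μ q) a (1 - q) := by
  funext h
  by_cases h0 : h = 0
  · subst h0
    have h1 : ¬ a ≤ 0 := by omega
    have h2 : (0 : ℕ) ≠ a := by omega
    simp [shiftBut, gate_apply, h1, h2]
  · by_cases hah : a ≤ h
    · by_cases hha : h = a
      · subst hha
        simp [shiftBut, gate_apply, h0]
      · have h3 : h - a ≠ 0 := by omega
        simp [shiftBut, gate_apply, h0, hah, hha, h3]
    · have hha : h ≠ a := by omega
      simp [shiftBut, gate_apply, h0, hah, hha]

/-- the gated slice is the `g`-mixture of the gated law and the gated shift: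
`gate_q(slice μ a g) = (1−g)·gate_q μ + g·gate_q(μ(·−a))`. [this work] -/
theorem gate_slice_eq_mix (μ : ℕ → ℝ) (q g : ℝ) (a : ℕ) :
    gate (slice μ a g) q = fun h => (1 - g) * gate μ q h + g * gate (fun t => if a ≤ t then μ (t - a) else 0) q h := by
  funext h
  simp only [gate_apply, slice]
  ring

/-! ### The layers below the blob: `j < a` (criterion E) -/

/-- law facts of `shiftBut ν a z` (`a ≥ 1`, `0 ≤ z ≤ ν 0`): nonnegative, vanishing above `M + a`, mass `1`, and its mass above any
layer `j < a` is `1 − z`. [this work] -/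
theorem shiftBut_laws (ν : ℕ → ℝ) (a M : ℕ) (z : ℝ) (ha : 1 ≤ a) (hz0 : 0 ≤ z) (hzν : z ≤ ν 0)
    (hν0 : ∀ h, 0 ≤ ν h) (hνM : ∀ h, M < h → ν h = 0) (hν1 : ∑ h ∈ Finset.range (M + 1), ν h = 1) :
    (∀ h, 0 ≤ shiftBut ν a z h) ∧ (∀ h, M + a < h → shiftBut ν a z h = 0) ∧
      (∑ h ∈ Finset.range (M + a + 1), shiftBut ν a z h = 1) ∧
      (∀ j, j < a → ∑ h ∈ Finset.Ico (j + 1) (M + a + 1), shiftBut ν a z h = 1 - z) := by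
  have happ : ∀ h, shiftBut ν a z h = (if h = 0 then z else 0) + (if a ≤ h then ν (h - a) else 0) - (if h = a then z else 0) :=
    fun h => rfl
  -- the shifted part sums to 1 over `[a, M+a]`-containing ranges
  have hshift : ∀ j, j < a → ∑ h ∈ Finset.Ico (j + 1) (M + a + 1), (if a ≤ h then ν (h - a) else 0) = 1 := by
    intro j hj
    have hsplit := (Finset.sum_Ico_consecutive (fun h => if a ≤ h then ν (h - a) else 0)
      (show j + 1 ≤ a by omega) (show a ≤ M + a + 1 by omega)).symm
    rw [hsplit]
    have hz : ∑ h ∈ Finset.Ico (j + 1) a, (if a ≤ h then ν (h - a) else 0) = 0 :=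
      Finset.sum_eq_zero fun h hh => if_neg (by have := (Finset.mem_Ico.1 hh).2; omega)
    rw [hz, zero_add, Finset.sum_Ico_eq_sum_range, show M + a + 1 - a = M + 1 by omega]
    rw [← hν1]
    refine Finset.sum_congr rfl fun k _ => ?_
    rw [if_pos (by omega), show a + k - a = k by omega]
  refine ⟨fun h => ?_, fun h hh => ?_, ?_, fun j hj => ?_⟩
  · rw [happ]
    by_cases h0 : h = 0
    · subst h0; rw [if_pos rfl, if_neg (by omega), if_neg (by omega)]; linarith
    · rw [if_neg h0]
      by_cases hha : h = a
      · subst hha; rw [if_pos le_rfl, if_pos rfl, Nat.sub_self]; linarith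
      · rw [if_neg hha]; split_ifs <;> linarith [hν0 (h - a)]
  · rw [happ, if_neg (by omega), if_pos (by omega), if_neg (by omega), hνM (h - a) (by omega)]; ring
  · rw [Finset.sum_range_succ' _ (M + a)]
    have e0 : shiftBut ν a z 0 = z := by rw [happ, if_pos rfl, if_neg (by omega), if_neg (by omega)]; ring
    rw [e0]
    have e1 : ∑ k ∈ Finset.range (M + a), shiftBut ν a z (k + 1) = ∑ h ∈ Finset.Ico (0 + 1) (M + a + 1), shiftBut ν a z h := by
      rw [Finset.sum_Ico_eq_sum_range, show M + a + 1 - (0 + 1) = M + a by omega]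
      exact Finset.sum_congr rfl fun k _ => by rw [show 0 + 1 + k = k + 1 by omega]
    rw [e1]
    have hIco : ∑ h ∈ Finset.Ico (0 + 1) (M + a + 1), shiftBut ν a z h = 1 - z := by
      simp only [happ, Finset.sum_add_distrib, Finset.sum_sub_distrib]
      rw [hshift 0 (by omega)]
      rw [Finset.sum_eq_zero (fun h hh => if_neg (by have := (Finset.mem_Ico.1 hh).1; omega) :
        ∀ h ∈ Finset.Ico (0 + 1) (M + a + 1), (if h = 0 then z else (0 : ℝ)) = 0)]
      rw [Finset.sum_ite_eq' (Finset.Ico (0 + 1) (M + a + 1)) a (fun _ => z), if_pos (Finset.mem_Ico.2 ⟨by omega, by omega⟩)]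
      ring
    rw [hIco]; ring
  · simp only [happ, Finset.sum_add_distrib, Finset.sum_sub_distrib]
    rw [hshift j hj]
    rw [Finset.sum_eq_zero (fun h hh => if_neg (by have := (Finset.mem_Ico.1 hh).1; omega) :
      ∀ h ∈ Finset.Ico (j + 1) (M + a + 1), (if h = 0 then z else (0 : ℝ)) = 0)]
    rw [Finset.sum_ite_eq' (Finset.Ico (j + 1) (M + a + 1)) a (fun _ => z), if_pos (Finset.mem_Ico.2 ⟨by omega, by omega⟩)]
    ring

/-- **`MixedShiftDEC` AT THE LAYERS `j < a`, unconditionally (neither DEC hypothesis is used).**  Every shifted atom lies above the layer,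
so the giants of the mixture carry mass `≥ g·(1 − z) ≥ y`: criterion E (arm-1 g39's `decAtT_of_giantMass_ge`, the mechanism of their `twinMove_of_lt`). [this work] -/
theorem mixedShift_of_lt (y z g S : ℝ) (a j M : ℕ) (ν : ℕ → ℝ)
    (hy0 : 0 < y) (hy1 : y < 1) (hz0 : 0 ≤ z) (hzν : z ≤ ν 0) (hg1 : g ≤ 1) (hyg : y ≤ (1 - z) * g) (ha : 1 ≤ a)
    (hν0 : ∀ h, 0 ≤ ν h) (hνM : ∀ h, M < h → ν h = 0) (hν1 : ∑ h ∈ Finset.range (M + 1), ν h = 1) (hja : j < a) :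
    DECAtT y (S + (a : ℝ) * g * (1 - z)) j (M + a) (fun h => (1 - g) * ν h + g * shiftBut ν a z h) := by
  obtain ⟨w0, wM, w1, wtail⟩ := shiftBut_laws ν a M z ha hz0 hzν hν0 hνM hν1
  have hν01 : ν 0 ≤ 1 := by
    have h01 := Finset.single_le_sum (f := ν) (fun h _ => hν0 h) (Finset.mem_range.2 (Nat.succ_pos M))
    rwa [hν1] at h01
  have hg0 : 0 ≤ g := by
    by_contra hc
    have hng : (1 - z) * g ≤ 0 := mul_nonpos_of_nonneg_of_nonpos (by linarith) (le_of_lt (not_le.1 hc))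
    linarith
  have hνM' : ∀ h, M + a < h → ν h = 0 := fun h hh => hνM h (by omega)
  have hν1' : ∑ h ∈ Finset.range (M + a + 1), ν h = 1 := by
    rw [← Finset.sum_range_add_sum_Ico ν (show M + 1 ≤ M + a + 1 by omega), hν1,
      Finset.sum_eq_zero (fun h hh => hνM h (by have := (Finset.mem_Ico.1 hh).1; omega)), add_zero]
  refine decAtT_of_giantMass_ge y _ j (M + a) _ hy0 hy1 (fun h => by nlinarith [hν0 h, w0 h]) (fun h hh => by
    rw [hνM' h hh, wM h hh]; ring) ?_ ?_
  · rw [Finset.sum_add_distrib, ← Finset.mul_sum, ← Finset.mul_sum, hν1', w1]; ring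
  · rw [Finset.sum_add_distrib, ← Finset.mul_sum, ← Finset.mul_sum, wtail j hja]
    have : 0 ≤ ∑ i ∈ Finset.Ico (j + 1) (M + a + 1), ν i := Finset.sum_nonneg fun h _ => hν0 h
    nlinarith

/-! ### PM in full from the conjecture -/

/-- **`MixedShiftDEC ⟹ SDEC-UP-TO-`Q` IS CLOSED UNDER SLICING BY ANY HEAVY BLOB `{0, a; g}`** (`x ≤ g ≤ 1`, `a ≥ 1`): `μ` a
top-affordable probability law on `{0..M}`, SDEC up to `Q` at floor `x` (`0 < x`, `Q ≤ 1`, `Qx < 1`) ⟹ `slice μ a g` is SDEC up to `Q` at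
`x` on `{0..M+a}`.  Per gate `q ≤ Q` and layer `j < M + a`: `gate_q(slice μ a g) = (1−g)·gate_q μ + g·gate_q(μ(·−a))`
(`gate_slice_eq_mix`); `gate_q μ` is DEC at layer `j` by `SDECUpTo` (`j < M`) or Theorem A (`j ≥ M`); `gate_q(μ(·−a)) = shiftBut (gate_q μ) a (1−q)`
is DEC at layer `j` by Conjecture R (`gatedShift_sdecUpTo`, typer g26); the conjecture mixes them (`y = qx ≤ q·g = (1−z)g`).  Tree reading:
a glued class of `a` relays at any gate `g ≥ x` hung beside ANY SDEC subtree under a common gate keeps SDEC — PM in full, the blob case of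
leg (III). [this work] -/
theorem sdecUpTo_slice_of_mixedShift (hMS : MixedShiftDEC) (x Q g : ℝ) (a M : ℕ) (μ : ℕ → ℝ) (hx0 : 0 < x) (hx1 : x ≤ 1)
    (hQ1 : Q ≤ 1) (hQx : Q * x < 1) (hxg : x ≤ g) (hg1 : g ≤ 1) (ha : 1 ≤ a)
    (hμ0 : ∀ h, 0 ≤ μ h) (hμM : ∀ h, M < h → μ h = 0) (hμ1 : ∑ h ∈ Finset.range (M + 1), μ h = 1)
    (hta : x * (M : ℝ) ≤ ∑ h ∈ Finset.range (M + 1), (h : ℝ) * μ h)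
    (hS : SDECUpTo x Q M μ) :
    SDECUpTo x Q (M + a) (slice μ a g) := by
  intro q hq0 hqQ j hj
  set T : ℝ := ∑ h ∈ Finset.range (M + 1), (h : ℝ) * μ h with hT
  set y : ℝ := q * x with hy
  have hq1 : q ≤ 1 := hqQ.trans hQ1
  have hy0 : 0 < y := mul_pos hq0 hx0
  have hy1 : y < 1 := lt_of_le_of_lt (mul_le_mul_of_nonneg_right hqQ hx0.le) hQx
  have hyqg : y ≤ (1 - (1 - q)) * g := by rw [hy, sub_sub_cancel]; exact mul_le_mul_of_nonneg_left hxg hq0.le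
  obtain ⟨n0, nM, n1⟩ := gate_laws M μ q hq0.le hq1 hμ0 hμM hμ1
  have nmean : ∑ h ∈ Finset.range (M + 1), (h : ℝ) * gate μ q h = q * T := sum_mul_gate μ q M
  have htaν : y * (M : ℝ) ≤ q * T := by rw [hy, mul_assoc]; exact mul_le_mul_of_nonneg_left hta hq0.le
  have hzν : 1 - q ≤ gate μ q 0 := by rw [gate_apply, if_pos rfl]; nlinarith [hμ0 0]
  -- hypothesis A: `gate_q μ` DEC at layer `j` (SDEC below the top, Theorem A at or above it)
  have hA : DECAtT y (q * T) j (M + a) (gate μ q) := by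
    refine decAtT_mono_top ?_ (Nat.le_add_right M a)
    by_cases hjM : j < M
    · have := hS q hq0 hqQ j hjM
      rwa [decAt_iff_decAtT, nmean] at this
    · have htop : ∀ h, 0 < gate μ q h → y * (h : ℝ) ≤ ∑ k ∈ Finset.range (M + 1), (k : ℝ) * gate μ q k := by
        intro h hh
        have hhM : h ≤ M := by
          by_contra hc
          exact (ne_of_gt hh) (nM h (not_le.1 hc))
        rw [nmean]
        have : y * (h : ℝ) ≤ y * M := mul_le_mul_of_nonneg_left (by exact_mod_cast hhM) hy0.le
        linarith
      have := decAt_of_top_le M (gate μ q) n0 nM n1 y hy1 htop j (not_lt.1 hjM)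
      rwa [decAt_iff_decAtT, nmean] at this
  -- hypothesis B: the gated shift `gate_q(μ(·−a))` DEC at layer `j` (Conjecture R, typer g26)
  have hB : DECAtT y (q * T + (a : ℝ) * (1 - (1 - q))) j (M + a) (shiftBut (gate μ q) a (1 - q)) := by
    have hR := gatedShift_sdecUpTo x Q a M μ hx0 hx1 hQ1 hQx ha hμ0 hμM hμ1 hta hS q hq0 hqQ j (by omega)
    obtain ⟨_, _, _, smean⟩ := shift_laws a M μ hμ0 hμM hμ1
    have smean' : ∑ t ∈ Finset.range (a + M + 1), (t : ℝ) * (if a ≤ t then μ (t - a) else 0) = T + a := smean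
    rw [decAt_iff_decAtT, sum_mul_gate, smean', show a + M = M + a by omega, gate_shift_eq_shiftBut μ q a ha] at hR
    convert hR using 2
    ring
  -- the conjecture mixes them
  have hmix := hMS y (1 - q) g (q * T) a j M (gate μ q) hy0 hy1 (by linarith) hzν hg1 hyqg ha n0 nM n1 nmean.symm htaν hA hB
  have hsmean : ∑ h ∈ Finset.range (M + a + 1), (h : ℝ) * slice μ a g h = T + (a : ℝ) * g := sum_mul_slice μ a g M hμM hμ1
  rw [decAt_iff_decAtT, sum_mul_gate, hsmean, gate_slice_eq_mix, gate_shift_eq_shiftBut μ q a ha]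
  convert hmix using 2
  ring

/-- **`MixedShiftDEC ⟹ SDEC IS CLOSED UNDER SLICING BY ANY HEAVY BLOB`** (`Q = 1`): `0 < x < 1`, `x ≤ g ≤ 1`, `a ≥ 1`, `μ` a top-affordable
probability law on `{0..M}`, SDEC at `x` ⟹ `slice μ a g` is SDEC at `x` on `{0..M+a}`. [this work] -/
theorem sdec_slice_of_mixedShift (hMS : MixedShiftDEC) (x g : ℝ) (a M : ℕ) (μ : ℕ → ℝ) (hx0 : 0 < x) (hx1 : x < 1)
    (hxg : x ≤ g) (hg1 : g ≤ 1) (ha : 1 ≤ a) (hμ0 : ∀ h, 0 ≤ μ h) (hμM : ∀ h, M < h → μ h = 0)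
    (hμ1 : ∑ h ∈ Finset.range (M + 1), μ h = 1)
    (hta : x * (M : ℝ) ≤ ∑ h ∈ Finset.range (M + 1), (h : ℝ) * μ h) (hS : SDEC x M μ) :
    SDEC x (M + a) (slice μ a g) := by
  rw [← sdecUpTo_one_iff] at hS ⊢
  exact sdecUpTo_slice_of_mixedShift hMS x 1 g a M μ hx0 hx1.le le_rfl (by rwa [one_mul]) hxg hg1 ha hμ0 hμM hμ1 hta hS

end LawDec

end Quant

end Summit.CriticalPhenomena.PercolationContinuityZ3.Theorems
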